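import Summits.BirchSwinnertonDyer.Rank1Residual.X1.PadicSigmaThreeUniversalRing
import HarnessLib

/-!
# The universal chart over `R̂₃ = ℤ[Y, A₄, A₆][1/Y]^₃`: the universal ordinary `a₂`-curve, its unit
# Hasse coefficients, specialisations and Frobenius congruences (module M2b of the x1a design for the
# Mazur–Tate sigma function at `p = 3`)

HONEST FRAMING (cell `b2b-bsdres`, run/shared/lean/b2b/bsd-rank1-residual/, verbatim in every file):
the goal of the cell is to DELETE the COMBINATION-SHAPED residual classes of the Birch–Swinnerton-Dyer
formula for ALL analytic-rank `≤ 1` elliptic curves over `ℚ` — "full BSD formula for every rank `≤ 1`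
curve in class `C`" assembled STRICTLY from published theorems — so that the rank-`≤ 1` remainder
becomes exactly the CONSTRUCTION-SHAPED classes, which are TYPED (missing-input `Prop`s), NOT
attempted. This is not "finishing BSD". CLASS-OWNERS.md row "X1 (r = 1)": research route; NO CLAIM
BEYOND STATED CLASSES; nothing is booked by this file; no preprint enters; no named fact.

Unit `b2b-bsdres-x1a` (X1 prover A, gen 20). Sequel of `X1/PadicSigmaThreeUniversalRing.lean` (`R̂₃`,
`univY`, `univA4`, `univA6`, the units `Y`, `Y³ + 27A₆`, `2`). WHAT.
* **`univChart : Chart R̂₃`** (the three variables with the three inverses) and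
  **`universalCurve = univChart.curve`** (`y² = x³ + a₂(Y,A₄,A₆)x² + A₄x + A₆`), whose Hasse coefficient
  `w₂ = hasseCoeff 3 = 4a₂ ≡ -4Y (mod 3)` and all `w_{3ⁿ⁺¹-1}` are UNITS
  (`isUnit_coeff_formalInvDiff_universalCurve[_pow]`: the ordinarity hypothesis of Blakestad–Grant's
  Thm 2, tree `exists_padicWeierstrassZetaConst`);
* **`specialize y a₄ a₆ (hy : IsUnit y) : R̂₃ →+* A`** into any `3`-adically complete ring
  (Blakestad–Grant Thm 15 for the chart: `Y ↦ y`, `Aᵢ ↦ aᵢ`; `specialize_univY/A4/A6`), `ringHom_ext`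
  (maps out of `R̂₃` are determined by the three images);
* Frobenius congruences on `ℤ[Y, A₄, A₆]` (`eval₂Hom_sub_pow_mem`) and their propagation to `R̂₃`:
  **`specialize_sub_pow_mem`** — if `y ≡ Y³`, `a₄ ≡ A₄³`, `a₆ ≡ A₆³ (mod 3)` then the endomorphism
  `α = specialize y a₄ a₆` of `R̂₃` satisfies `α(x) ≡ x³ (mod 3)` for ALL `x` (Blakestad–Grant Def. 8;
  the hypothesis of Dwork's lemma `coeff_exp_sigmaExpArg_mem_of_isogeny`). The Frobenius lift of the
  design is `α` at `(Y', a₄', a₆')` with `Y'` the Hensel root near `Y³` of the quartic of the quotient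
  model `𝓔'` (module M4).

References: C. Blakestad, D. Grant, J. Number Theory 249 (2023) 348–376, §2.1–2.2, Def. 8, Thm. 15
[BlakestadGrant2023]; the tree file `Literature/NumberTheory/EllipticCurves/UniversalOrdinaryRing.lean`
(constructions repeated with `(Fin 3, Y)` for `(Fin 2, H)`). HOME/b2b-bsdres-x1a/gen20/A34-P3-DESIGN.md §4.

Definitions (with bodies): `univChart`, `universalCurve`, `specializeAway`, `specialize`. No named facts,
no `sorry`.
-/

noncomputable section

open Polynomial

namespace Summit.BirchSwinnertonDyer.Rank1Residual.X1.PadicSigmaThree.Universal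

open Literature.RingTheory.AdicTopology Literature.NumberTheory.EllipticCurves

/-! ## The universal chart and the universal curve -/

/-- **The universal chart over `R̂₃`**: `(Y, A₄, A₆)` with the inverses of `Y`, `Y³ + 27A₆`, `2`.
[cite: BlakestadGrant2023, §2.1] -/
def univChart : Chart completeRing where
  Y := univY
  A4 := univA4
  A6 := univA6
  yi := ↑(isUnit_univY.unit⁻¹)
  ei := ↑(isUnit_E.unit⁻¹)
  i2 := ↑(isUnit_two.unit⁻¹)
  Y_mul_yi := isUnit_univY.mul_val_inv
  E_mul_ei := isUnit_E.mul_val_inv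
  two_mul_i2 := isUnit_two.mul_val_inv

/-- `univChart.Y = Y`. [folklore] -/
@[simp] theorem univChart_Y : univChart.Y = univY := rfl
/-- `univChart.A4 = A₄`. [folklore] -/
@[simp] theorem univChart_A4 : univChart.A4 = univA4 := rfl
/-- `univChart.A6 = A₆`. [folklore] -/
@[simp] theorem univChart_A6 : univChart.A6 = univA6 := rfl

/-- **The universal ordinary `a₂`-curve `𝓔 : y² = x³ + a₂(Y,A₄,A₆)x² + A₄x + A₆` over `R̂₃`.**
[cite: BlakestadGrant2023, §2.1] -/
abbrev universalCurve : WeierstrassCurve completeRing := univChart.curve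

/-- The Hasse coefficient at `3` of an `a₂`-model is `b₂ = 4a₂`. [folklore] -/
theorem hasseCoeff_three {A : Type*} [CommRing A] (c : Chart A) : c.curve.hasseCoeff 3 = 4 * c.a2 := by
  rw [WeierstrassCurve.hasseCoeff, show (3 - 1) / 2 = 1 from rfl, show 3 - 1 = 2 from rfl, pow_one, Cubic.coeff_eq_b]
  simp [WeierstrassCurve.twoTorsionPolynomial, WeierstrassCurve.b₂]

/-- `4a₂ = 4Y·(-1) + 3·(…)`: the Hasse coefficient is `≡ -4Y (mod 3)`. [folklore] -/
theorem four_mul_a2_eq {A : Type*} [CommRing A] (c : Chart A) :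
    4 * c.a2 = -(4 * c.Y) + 3 * ((c.Y ^ 2 - 3 * c.A4) ^ 2 * c.ei * (4 * c.i2 ^ 2)) := by
  linear_combination 4 * c.a2_add_Y

/-- **The Hasse coefficient `w₂` of `ω_𝓔` is a unit of `R̂₃`** (ordinarity of the universal family;
`w₂ ≡ hasseCoeff 3 = 4a₂ ≡ -4Y (mod 3)`). [cite: BlakestadGrant2023, Prop. 3] -/
theorem isUnit_coeff_formalInvDiff_universalCurve : IsUnit (PowerSeries.coeff (3 - 1) universalCurve.formalInvDiff) := by
  rw [← UniversalOrdinary.isUnit_hasseCoeff_iff_isUnit_coeff_formalInvDiff 3 (by norm_num), hasseCoeff_three,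
    four_mul_a2_eq]
  refine isUnit_of_isUnit_mk (Ideal.span {(3 : completeRing)}) ?_
  have h3 : Ideal.Quotient.mk (Ideal.span {(3 : completeRing)})
      (3 * ((univChart.Y ^ 2 - 3 * univChart.A4) ^ 2 * univChart.ei * (4 * univChart.i2 ^ 2))) = 0 :=
    Ideal.Quotient.eq_zero_iff_mem.mpr (Ideal.mem_span_singleton.mpr (dvd_mul_right _ _))
  rw [map_add, h3, add_zero, map_neg, IsUnit.neg_iff, map_mul]
  exact ((isUnit_two.pow 2).map _ |>.mul (isUnit_univY.map _)) |> fun h => by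
    simpa only [map_pow, show ((2 : completeRing) ^ 2) = 4 by norm_num, univChart_Y] using h

/-- All the Hasse coefficients `w_{3ⁿ⁺¹-1}` of `ω_𝓔` are units. [cite: BlakestadGrant2023, Prop. 3] -/
theorem isUnit_coeff_formalInvDiff_universalCurve_pow (n : ℕ) :
    IsUnit (PowerSeries.coeff (3 ^ (n + 1) - 1) universalCurve.formalInvDiff) :=
  universalCurve.isUnit_coeff_formalInvDiff_prime_pow_sub_one 3 (by norm_num) isUnit_coeff_formalInvDiff_universalCurve n

/-! ## Specialisation (Blakestad–Grant Thm 15) and endomorphisms (Def 8) -/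

section Specialize

variable {A : Type*} [CommRing A] (y a₄ a₆ : A) (hy : IsUnit y)

/-- `ℤ[Y,A₄,A₆][1/Y] → A`, `(Y, A₄, A₆) ↦ (y, a₄, a₆)` for a unit `y`. [cite: BlakestadGrant2023, Thm. 15] -/
def specializeAway : localizedRing →+* A :=
  IsLocalization.Away.lift Yv (g := MvPolynomial.eval₂Hom (Int.castRingHom A) ![y, a₄, a₆])
    (by rwa [Yv, MvPolynomial.coe_eval₂Hom, MvPolynomial.eval₂_X])

/-- `specializeAway` on `ℤ[Y,A₄,A₆]` is evaluation. [folklore] -/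
theorem specializeAway_algebraMap (q : coeffRing) :
    specializeAway y a₄ a₆ hy (algebraMap coeffRing localizedRing q) = MvPolynomial.eval₂Hom (Int.castRingHom A) ![y, a₄, a₆] q :=
  IsLocalization.Away.lift_eq Yv _ q

variable [IsAdicComplete (Ideal.span {((3 : ℕ) : A)}) A]

/-- **The specialisation `ρ : R̂₃ → A`, `(Y, A₄, A₆) ↦ (y, a₄, a₆)`** into a `3`-adically complete ring
(`y` a unit). [cite: BlakestadGrant2023, Thm. 15] -/
def specialize : completeRing →+* A :=
  liftNatCast localizedRing 3 (specializeAway y a₄ a₆ hy)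

/-- `ρ` on `ℤ[Y,A₄,A₆]` is evaluation. [folklore] -/
theorem specialize_algebraMap (q : coeffRing) :
    specialize y a₄ a₆ hy (algebraMap coeffRing completeRing q) = MvPolynomial.eval₂Hom (Int.castRingHom A) ![y, a₄, a₆] q := by
  rw [algebraMap_coeffRing_apply, specialize, liftNatCast_algebraMap, specializeAway_algebraMap]

/-- `ρ(Y) = y`. [cite: BlakestadGrant2023, Thm. 15] -/
theorem specialize_univY : specialize y a₄ a₆ hy univY = y := by
  rw [univY, specialize_algebraMap, Yv, MvPolynomial.coe_eval₂Hom, MvPolynomial.eval₂_X]; rfl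

/-- `ρ(A₄) = a₄`. [cite: BlakestadGrant2023, Thm. 15] -/
theorem specialize_univA4 : specialize y a₄ a₆ hy univA4 = a₄ := by
  rw [univA4, specialize_algebraMap, A4v, MvPolynomial.coe_eval₂Hom, MvPolynomial.eval₂_X]; rfl

/-- `ρ(A₆) = a₆`. [cite: BlakestadGrant2023, Thm. 15] -/
theorem specialize_univA6 : specialize y a₄ a₆ hy univA6 = a₆ := by
  rw [univA6, specialize_algebraMap, A6v, MvPolynomial.coe_eval₂Hom, MvPolynomial.eval₂_X]; rfl

end Specialize

/-- **Ring maps out of `R̂₃` into a `3`-adically separated ring are determined by the images of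
`Y, A₄, A₆`.** [folklore] -/
theorem ringHom_ext {B : Type*} [CommRing B] [IsHausdorff (Ideal.span {((3 : ℕ) : B)}) B]
    {ψ ψ' : completeRing →+* B} (hY : ψ univY = ψ' univY) (h4 : ψ univA4 = ψ' univA4) (h6 : ψ univA6 = ψ' univA6) :
    ψ = ψ' := by
  refine ringHom_ext_natCast (R := localizedRing) 3 fun r => ?_
  suffices hcomp : ψ.comp (algebraMap localizedRing completeRing) = ψ'.comp (algebraMap localizedRing completeRing) from
    RingHom.congr_fun hcomp r
  refine IsLocalization.ringHom_ext (Submonoid.powers Yv) ?_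
  refine MvPolynomial.ringHom_ext (fun n => by simp only [eq_intCast, map_intCast]) fun i => ?_
  simp only [RingHom.comp_apply, ← algebraMap_coeffRing_apply]
  fin_cases i
  · exact hY
  · exact h4
  · exact h6

/-- **Frobenius congruences on `ℤ[Y, A₄, A₆]`**: if `I ∋ p` and `b_j ≡ φ(X_j)ᵖ (mod I)` for the three
variables, then evaluation at `b` is congruent to `φ(·)ᵖ` modulo `I` on all of `ℤ[Y,A₄,A₆]`. [folklore] -/
theorem eval₂Hom_sub_pow_mem (p : ℕ) [Fact p.Prime] {B : Type*} [CommRing B] (φ : coeffRing →+* B) (b : Fin 3 → B)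
    (I : Ideal B) (hpI : (p : B) ∈ I) (hb : ∀ i, b i - φ (MvPolynomial.X i) ^ p ∈ I) (q : coeffRing) :
    MvPolynomial.eval₂Hom (Int.castRingHom B) b q - φ q ^ p ∈ I := by
  have hp : p.Prime := Fact.out
  induction q using MvPolynomial.induction_on with
  | C r =>
    rw [MvPolynomial.coe_eval₂Hom, MvPolynomial.eval₂_C, eq_intCast, eq_intCast, map_intCast]
    have hdvd : (p : ℤ) ∣ r - r ^ p := by
      rw [← ZMod.intCast_zmod_eq_zero_iff_dvd, Int.cast_sub, Int.cast_pow, ZMod.pow_card, sub_self]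
    obtain ⟨c, hc⟩ := hdvd
    have e : ((r : B) - (r : B) ^ p) = (p : B) * (c : B) := by exact_mod_cast congrArg (Int.cast (R := B)) hc
    rw [e]
    exact I.mul_mem_right _ hpI
  | add q₁ q₂ ih₁ ih₂ =>
    obtain ⟨c, hc⟩ := exists_add_pow_prime_eq hp (φ q₁) (φ q₂)
    have e : MvPolynomial.eval₂Hom (Int.castRingHom B) b (q₁ + q₂) - φ (q₁ + q₂) ^ p =
        (MvPolynomial.eval₂Hom (Int.castRingHom B) b q₁ - φ q₁ ^ p) +
        (MvPolynomial.eval₂Hom (Int.castRingHom B) b q₂ - φ q₂ ^ p) - (p : B) * φ q₁ * φ q₂ * c := by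
      rw [map_add, map_add, hc]; ring
    rw [e]
    exact sub_mem (add_mem ih₁ ih₂) (I.mul_mem_right _ (I.mul_mem_right _ (I.mul_mem_right _ hpI)))
  | mul_X q i ih =>
    have e : MvPolynomial.eval₂Hom (Int.castRingHom B) b (q * MvPolynomial.X i) - φ (q * MvPolynomial.X i) ^ p =
        (MvPolynomial.eval₂Hom (Int.castRingHom B) b q - φ q ^ p) * b i + φ q ^ p * (b i - φ (MvPolynomial.X i) ^ p) := by
      rw [map_mul, map_mul, MvPolynomial.coe_eval₂Hom, MvPolynomial.eval₂_X, mul_pow]; ring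
    rw [e]
    exact add_mem (I.mul_mem_right _ ih) (I.mul_mem_left _ (hb i))

/-- **An endomorphism `α = specialize y a₄ a₆` of `R̂₃` with `y ≡ Y³`, `a₄ ≡ A₄³`, `a₆ ≡ A₆³ (mod 3)`
reduces to the Frobenius: `α(x) ≡ x³ (mod 3)` for all `x ∈ R̂₃`** (Blakestad–Grant Def. 8: the
congruence holds on `ℤ[Y,A₄,A₆]`, passes to the localisation because `α` of a power of `Y` is a unit,
and to the completion by `sub_pow_mem_span_of_forall_algebraMap`). [cite: BlakestadGrant2023, Def. 8] -/
theorem specialize_sub_pow_mem (y a₄ a₆ : completeRing) (hy : IsUnit y)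
    (hY : y - univY ^ 3 ∈ Ideal.span {(3 : completeRing)}) (h4 : a₄ - univA4 ^ 3 ∈ Ideal.span {(3 : completeRing)})
    (h6 : a₆ - univA6 ^ 3 ∈ Ideal.span {(3 : completeRing)}) (x : completeRing) :
    specialize y a₄ a₆ hy x - x ^ 3 ∈ Ideal.span {(3 : completeRing)} := by
  set I := Ideal.span {(3 : completeRing)} with hI
  set f := specializeAway y a₄ a₆ hy with hf
  set u := algebraMap localizedRing completeRing with hu
  -- on `ℤ[Y, A₄, A₆]`
  have hpoly : ∀ q : coeffRing, MvPolynomial.eval₂Hom (Int.castRingHom completeRing) ![y, a₄, a₆] q -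
      algebraMap coeffRing completeRing q ^ 3 ∈ I := by
    intro q
    refine eval₂Hom_sub_pow_mem 3 (algebraMap coeffRing completeRing) ![y, a₄, a₆] I
      (Ideal.mem_span_singleton_self _) (fun i => ?_) q
    fin_cases i
    · exact hY
    · exact h4
    · exact h6
  -- on the localisation
  have hloc : ∀ z : localizedRing, f z - u z ^ 3 ∈ I := by
    intro z
    obtain ⟨⟨q, s⟩, hqs⟩ := IsLocalization.surj (Submonoid.powers Yv) z
    simp only at hqs
    have hsu : IsUnit (algebraMap coeffRing localizedRing (s : coeffRing)) := IsLocalization.map_units localizedRing s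
    have hunit : IsUnit (f (algebraMap coeffRing localizedRing s)) := hsu.map f
    have hc : f (algebraMap coeffRing localizedRing q) - u (algebraMap coeffRing localizedRing q) ^ 3 ∈ I := by
      rw [hf, specializeAway_algebraMap, hu, ← algebraMap_coeffRing_apply]; exact hpoly q
    have hs : f (algebraMap coeffRing localizedRing s) - u (algebraMap coeffRing localizedRing s) ^ 3 ∈ I := by
      rw [hf, specializeAway_algebraMap, hu, ← algebraMap_coeffRing_apply]; exact hpoly s
    have e : (f z - u z ^ 3) * f (algebraMap coeffRing localizedRing s) =
        (f (algebraMap coeffRing localizedRing q) - u (algebraMap coeffRing localizedRing q) ^ 3) +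
          u z ^ 3 * (u (algebraMap coeffRing localizedRing s) ^ 3 - f (algebraMap coeffRing localizedRing s)) := by
      have h1 : f z * f (algebraMap coeffRing localizedRing s) = f (algebraMap coeffRing localizedRing q) := by
        rw [← map_mul, hqs]
      have h2 : u z ^ 3 * u (algebraMap coeffRing localizedRing s) ^ 3 = u (algebraMap coeffRing localizedRing q) ^ 3 := by
        rw [← mul_pow, ← map_mul, hqs]
      rw [sub_mul, h1, ← h2]; ring
    rw [← Ideal.mul_unit_mem_iff_mem I hunit, e]
    exact add_mem hc (I.mul_mem_left _ (by rw [← neg_sub]; exact I.neg_mem hs))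
  -- on the completion
  have h := sub_pow_mem_span_of_forall_algebraMap ((3 : ℕ) : localizedRing) 3 (specialize y a₄ a₆ hy) ?_ ?_ x
  · rw [algebraMap_natCast] at h
    exact h
  · rw [algebraMap_natCast, map_natCast]; exact Ideal.mem_span_singleton_self _
  · intro z
    rw [algebraMap_natCast, specialize, liftNatCast_algebraMap]
    exact hloc z

end Summit.BirchSwinnertonDyer.Rank1Residual.X1.PadicSigmaThree.Universal

end
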